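import Summits.ResolutionOfSingularities.ResolutionOfSingularities.Theorems.HomologicalConductorForallTerminatesResidualFourFacts
import Summits.ResolutionOfSingularities.ResolutionOfSingularities.Theorems.HomologicalConductorNoZenoRMaxKernelDoor
import Summits.ResolutionOfSingularities.ResolutionOfSingularities.Theorems.HomologicalConductorNoZenoRLipman12B
import HarnessLib

/-!
# Cruxes `StrictDrop` (stmt-16485) / `NoZenoR` (stmt-19943) and kill test `SurfaceTermination` (stmt-16488):
# the dichotomy reduction and the crux doors modulo THREE prints (Lipman 1969 Prop. (1.2) is now a theorem)

Route `ResolutionOfSingularities/HomologicalConductor` (cell decomp-res, hand leafhand-res-homologicalconduct-18 g0).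
OURS: AI-written bookkeeping over tree theorems, weaker than expert review; nothing here is a statement of the manuscript
under review (Hironaka 2017).  SUPPORT level, counted 0.  Def-free, no new named facts.

Hand 3 g1 stated the kill-test reduction and both crux doors modulo the FOUR-print bundle
`CJS2020General ∧ Lipman1969_1_2 ∧ Lipman1969_4_1 ∧ Lipman1969_12_1_ii` (`…SurfaceTerminationReductionFourFacts`,
`…ForallTerminatesResidualFourFacts`, `…NoZenoRMaxKernelDoor`).  The conjunct `Lipman1969_1_2` (Lipman 1969, Prop. (1.2)) is
now the tree theorem `NoZeno.Lipman12B.Lipman1969_1_2_holds` (this hand, via statement B) = `Lipman1969_1_2_B_holds`: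
Stacks 081T domination + point-blow-up principalization on the regular surface), so every door holds modulo the THREE-print bundle
`CJS2020General ∧ Lipman1969_4_1 ∧ Lipman1969_12_1_ii` (one-line re-exports):

* `facts4_of_facts3`;
* kill test: `exhaustiveSurfaceTermination_of_facts3`, `surfaceTermination_iff_primeDivisorCase_of_facts3`,
  `surfaceTermination_of_strictDrop3`;
* `StrictDrop`: `strictDrop_of_facts3_of_primeDivisorCase_of_topDim'`;
* `NoZenoR`: `noZenoR_of_facts3_of_topDim`, `noZenoR_of_facts3_of_primeDivisorCase_of_topDim'`,
  `noZenoR_iff_topKernel_of_facts3`, `noZenoR_iff_maxKernel_of_facts3`;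
* joint: `forall_terminates_iff_primeDivisorCase_and_topDim'_of_facts3`, `cruxes_iff_primeDivisorCase_and_topDim'_of_facts3`.

EXACT REMAINING PRINT DEBT of the kill-test / crux doors after this file: Cossart–Jannsen–Saito 2020 Thm 1.2
(`CossartJannsenSaito2020General`), Lipman 1969 Thm. (4.1) (`Lipman1969_4_1`), Thm. (12.1)(ii) (`Lipman1969_12_1_ii`).
No crux, kill test or summit statement is proved here; resolution of singularities in positive characteristic is NOT proved.
-/

-- single-problem summit: the doubled namespace component `ResolutionOfSingularities` is forced
set_option linter.dupNamespace false

noncomputable section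

open Summit.ResolutionOfSingularities.ResolutionOfSingularities.Theses.HomologicalConductor
open Summit.ResolutionOfSingularities.ResolutionOfSingularities.Theorems
open Summit.ResolutionOfSingularities.ResolutionOfSingularities.Theorems.NoZeno.Birth
open Summit.ResolutionOfSingularities.ResolutionOfSingularities.Theorems.NoZeno
open Literature.AlgebraicGeometry.Resolution

namespace Summit.ResolutionOfSingularities.ResolutionOfSingularities.Theorems.SurfaceTermination.Reduction.ThreeFacts

/-- **The four-print bundle from THREE prints**: its conjunct `Lipman1969_1_2` is the tree theorem
`Lipman12B.Lipman1969_1_2_holds`. [cite: Lipman1969, Proposition (1.2) (p. 199)] -/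
theorem facts4_of_facts3
    (h3 : CossartJannsenSaito2020General.{0} ∧ Lipman1969_4_1.{0} ∧ Lipman1969_12_1_ii.{0}) :
    CossartJannsenSaito2020General.{0} ∧ Lipman1969_1_2.{0} ∧ Lipman1969_4_1.{0} ∧ Lipman1969_12_1_ii.{0} :=
  ⟨h3.1, Lipman12B.Lipman1969_1_2_holds, h3.2⟩

/-- **The four-print bundle is EQUIVALENT to the three-print bundle.** [cite: Lipman1969, Proposition (1.2) (p. 199)] -/
theorem facts4_iff_facts3 :
    (CossartJannsenSaito2020General.{0} ∧ Lipman1969_1_2.{0} ∧ Lipman1969_4_1.{0} ∧ Lipman1969_12_1_ii.{0}) ↔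
    (CossartJannsenSaito2020General.{0} ∧ Lipman1969_4_1.{0} ∧ Lipman1969_12_1_ii.{0}) :=
  ⟨fun h => ⟨h.1, h.2.2⟩, facts4_of_facts3⟩

/-! ## The kill test modulo three prints -/

/-- **(c1) modulo three prints: exhaustive surface towers terminate.** [cite: CossartJannsenSaito2020, Thm. 1.2] -/
theorem exhaustiveSurfaceTermination_of_facts3
    (h3 : CossartJannsenSaito2020General.{0} ∧ Lipman1969_4_1.{0} ∧ Lipman1969_12_1_ii.{0}) :
    ExhaustiveSurfaceTermination :=
  FourFacts.exhaustiveSurfaceTermination_of_facts4 (facts4_of_facts3 h3)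

/-- **(c2) modulo THREE prints, the kill test `SurfaceTermination` (stmt-16488) is EQUIVALENT to its prime-divisor case
(D-s).** [cite: ZariskiSamuel1960, Ch. VI §14, Thm. 31]; [cite: Lipman1969, Theorem (4.1), Theorem (12.1) (ii)] -/
theorem surfaceTermination_iff_primeDivisorCase_of_facts3
    (h3 : CossartJannsenSaito2020General.{0} ∧ Lipman1969_4_1.{0} ∧ Lipman1969_12_1_ii.{0}) :
    SurfaceTermination ↔ PrimeDivisorSurfaceTermination :=
  FourFacts.surfaceTermination_iff_primeDivisorCase_of_facts4 (facts4_of_facts3 h3)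

/-- **(c2′) modulo three prints: (D-s) ⇒ `SurfaceTermination`.** [cite: ZariskiSamuel1960, Ch. VI §14, Thm. 31] -/
theorem surfaceTermination_of_primeDivisorCase_of_facts3
    (h3 : CossartJannsenSaito2020General.{0} ∧ Lipman1969_4_1.{0} ∧ Lipman1969_12_1_ii.{0})
    (hDs : PrimeDivisorSurfaceTermination) : SurfaceTermination :=
  FourFacts.surfaceTermination_of_primeDivisorCase_of_facts4 (facts4_of_facts3 h3) hDs

/-- **(c3) `StrictDrop → SurfaceTermination` modulo THREE prints.** [cite: ZariskiSamuel1960, Ch. VI §10] -/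
theorem surfaceTermination_of_strictDrop3
    (h3 : CossartJannsenSaito2020General.{0} ∧ Lipman1969_4_1.{0} ∧ Lipman1969_12_1_ii.{0})
    (hD : StrictDrop) : SurfaceTermination :=
  FourFacts.surfaceTermination_of_strictDrop4 (facts4_of_facts3 h3) hD

/-! ## The crux doors modulo three prints -/

/-- **`NoZenoR` (stmt-19943) BY NAME ⟸ THREE prints + (TOP).**
[cite: Lipman1969, Theorem (4.1), Theorem (12.1) (ii)]; [cite: CossartJannsenSaito2020, Thm. 1.2] -/
theorem noZenoR_of_facts3_of_topDim
    (h3 : CossartJannsenSaito2020General.{0} ∧ Lipman1969_4_1.{0} ∧ Lipman1969_12_1_ii.{0})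
    (hTop : StrictDrop → ∀ p : ℕ, p.Prime → ∀ (k K : Type) [Field k] [CharP k p] [Field K] [Algebra k K]
      (O : ValuationSubring K) (A : Subalgebra k K), (∀ c : k, algebraMap k K c ∈ O) → A.FG →
      IsFractionRing ↥A K → A.toSubring ≤ O.toSubring → ¬ ringKrullDim ↥A ≤ 2 →
      (∀ n : ℕ, ringKrullDim ↥(tower O A n) = ringKrullDim ↥A) → ∃ m : ℕ, IsRegularLocalRing ↥(tower O A m)) :
    NoZenoR :=
  FourFacts.noZenoR_of_facts4_of_topDim (facts4_of_facts3 h3) hTop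

/-- **`StrictDrop` (stmt-16485) BY NAME ⟸ THREE prints + (D-s) + (TOP′).**
[cite: ZariskiSamuel1960, Ch. VI §14, Thm. 31]; [cite: Lipman1969, Theorem (4.1), Theorem (12.1) (ii)] -/
theorem strictDrop_of_facts3_of_primeDivisorCase_of_topDim'
    (h3 : CossartJannsenSaito2020General.{0} ∧ Lipman1969_4_1.{0} ∧ Lipman1969_12_1_ii.{0})
    (hDs : PrimeDivisorSurfaceTermination)
    (hTop : ∀ p : ℕ, p.Prime → ∀ (k K : Type) [Field k] [CharP k p] [Field K] [Algebra k K]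
      (O : ValuationSubring K) (A : Subalgebra k K), (∀ c : k, algebraMap k K c ∈ O) → A.FG →
      IsFractionRing ↥A K → A.toSubring ≤ O.toSubring → ¬ ringKrullDim ↥A ≤ 2 →
      (∀ n : ℕ, ringKrullDim ↥(tower O A n) = ringKrullDim ↥A) → ∃ m : ℕ, IsRegularLocalRing ↥(tower O A m)) :
    StrictDrop :=
  FourFacts.strictDrop_of_facts4_of_primeDivisorCase_of_topDim' (facts4_of_facts3 h3) hDs hTop

/-- **`NoZenoR` (stmt-19943) BY NAME ⟸ THREE prints + (D-s) + (TOP′).**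
[cite: ZariskiSamuel1960, Ch. VI §14, Thm. 31]; [cite: Lipman1969, Theorem (4.1), Theorem (12.1) (ii)] -/
theorem noZenoR_of_facts3_of_primeDivisorCase_of_topDim'
    (h3 : CossartJannsenSaito2020General.{0} ∧ Lipman1969_4_1.{0} ∧ Lipman1969_12_1_ii.{0})
    (hDs : PrimeDivisorSurfaceTermination)
    (hTop : ∀ p : ℕ, p.Prime → ∀ (k K : Type) [Field k] [CharP k p] [Field K] [Algebra k K]
      (O : ValuationSubring K) (A : Subalgebra k K), (∀ c : k, algebraMap k K c ∈ O) → A.FG →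
      IsFractionRing ↥A K → A.toSubring ≤ O.toSubring → ¬ ringKrullDim ↥A ≤ 2 →
      (∀ n : ℕ, ringKrullDim ↥(tower O A n) = ringKrullDim ↥A) → ∃ m : ℕ, IsRegularLocalRing ↥(tower O A m)) :
    NoZenoR :=
  FourFacts.noZenoR_of_facts4_of_primeDivisorCase_of_topDim' (facts4_of_facts3 h3) hDs hTop

/-- **THE EXACT RESIDUAL OF THE CRUX `NoZenoR` MODULO THREE PRINTS, kernel form**: given CJS 2020 Thm 1.2 and Lipman (4.1),
(12.1)(ii), `NoZenoR` ⟺ (TOP-ker). [cite: Lipman1969, Theorem (4.1), Theorem (12.1) (ii)]; [cite: CossartJannsenSaito2020, Thm. 1.2] -/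
theorem noZenoR_iff_topKernel_of_facts3
    (h3 : CossartJannsenSaito2020General.{0} ∧ Lipman1969_4_1.{0} ∧ Lipman1969_12_1_ii.{0}) :
    NoZenoR ↔
      (StrictDrop → ∀ p : ℕ, p.Prime → ∀ (k K : Type) [Field k] [CharP k p] [Field K] [Algebra k K]
        (O : ValuationSubring K) (A : Subalgebra k K), (∀ c : k, algebraMap k K c ∈ O) → A.FG →
        IsFractionRing ↥A K → A.toSubring ≤ O.toSubring → ¬ ringKrullDim ↥A ≤ 2 →
        (∀ n : ℕ, ringKrullDim ↥(tower O A n) = ringKrullDim ↥A) →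
        ¬ (∀ O' : ValuationSubring K,
          (∀ m : ℕ, ∀ s ∈ tower O A m, s ∈ O' ∧ (s⁻¹ ∈ O' → s⁻¹ ∈ O)) → ¬ IsNoetherianRing ↥O')) :=
  FourFacts.noZenoR_iff_topKernel_of_facts4 (facts4_of_facts3 h3)

/-- **THE EXACT RESIDUAL OF THE CRUX `NoZenoR` MODULO THREE PRINTS, maximal-kernel form.**
[cite: Lipman1969, Theorem (4.1), Theorem (12.1) (ii)]; [cite: CossartJannsenSaito2020, Thm. 1.2]; [cite: ZariskiSamuel1960, Ch. VI §5] -/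
theorem noZenoR_iff_maxKernel_of_facts3
    (h3 : CossartJannsenSaito2020General.{0} ∧ Lipman1969_4_1.{0} ∧ Lipman1969_12_1_ii.{0}) :
    NoZenoR ↔
      (StrictDrop → ∀ p : ℕ, p.Prime → ∀ (k K : Type) [Field k] [CharP k p] [Field K] [Algebra k K]
        (O : ValuationSubring K) (A : Subalgebra k K), (∀ c : k, algebraMap k K c ∈ O) → A.FG →
        IsFractionRing ↥A K → A.toSubring ≤ O.toSubring → ¬ ringKrullDim ↥A ≤ 2 →
        (∀ n : ℕ, ringKrullDim ↥(tower O A n) = ringKrullDim ↥A) →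
        (∀ O' : ValuationSubring K,
          (∀ m : ℕ, ∀ s ∈ tower O A m, s ∈ O' ∧ (s⁻¹ ∈ O' → s⁻¹ ∈ O)) → ¬ IsNoetherianRing ↥O') →
        (∀ O' : ValuationSubring K, O < O' → ∃ m : ℕ, ∃ s ∈ tower O A m, s⁻¹ ∈ O' ∧ s⁻¹ ∉ O) → False) :=
  FourFacts.noZenoR_iff_maxKernel_of_facts4 (facts4_of_facts3 h3)

/-! ## The joint residual modulo three prints -/

/-- **Modulo THREE prints, (UT) ⟺ (D-s) ∧ (TOP′)**: valuative termination of every canonical tower ⟺ its prime-divisor and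
top-dimensional special cases. [cite: ZariskiSamuel1960, Ch. VI §14, Thm. 31]; [cite: CossartJannsenSaito2020, Thm. 1.2] -/
theorem forall_terminates_iff_primeDivisorCase_and_topDim'_of_facts3
    (h3 : CossartJannsenSaito2020General.{0} ∧ Lipman1969_4_1.{0} ∧ Lipman1969_12_1_ii.{0}) :
    (∀ p : ℕ, p.Prime → ∀ (k K : Type) [Field k] [CharP k p] [Field K] [Algebra k K]
      (O : ValuationSubring K) (A : Subalgebra k K), (∀ c : k, algebraMap k K c ∈ O) → A.FG →
      IsFractionRing ↥A K → A.toSubring ≤ O.toSubring → ∃ m : ℕ, IsRegularLocalRing ↥(tower O A m)) ↔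
    (PrimeDivisorSurfaceTermination ∧
      ∀ p : ℕ, p.Prime → ∀ (k K : Type) [Field k] [CharP k p] [Field K] [Algebra k K]
        (O : ValuationSubring K) (A : Subalgebra k K), (∀ c : k, algebraMap k K c ∈ O) → A.FG →
        IsFractionRing ↥A K → A.toSubring ≤ O.toSubring → ¬ ringKrullDim ↥A ≤ 2 →
        (∀ n : ℕ, ringKrullDim ↥(tower O A n) = ringKrullDim ↥A) → ∃ m : ℕ, IsRegularLocalRing ↥(tower O A m)) :=
  FourFacts.forall_terminates_iff_primeDivisorCase_and_topDim'_of_facts4 (facts4_of_facts3 h3)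

/-- **THE EXACT JOINT RESIDUAL OF THE ROUTE'S OPEN CRUXES modulo THREE prints: `StrictDrop ∧ NoZenoR ⟺ (D-s) ∧ (TOP′)`.**
[cite: ZariskiSamuel1960, Ch. VI §14, Thm. 31]; [cite: Lipman1969, Theorem (4.1), Theorem (12.1) (ii)]; [cite: CossartJannsenSaito2020, Thm. 1.2] -/
theorem cruxes_iff_primeDivisorCase_and_topDim'_of_facts3
    (h3 : CossartJannsenSaito2020General.{0} ∧ Lipman1969_4_1.{0} ∧ Lipman1969_12_1_ii.{0}) :
    (StrictDrop ∧ NoZenoR) ↔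
    (PrimeDivisorSurfaceTermination ∧
      ∀ p : ℕ, p.Prime → ∀ (k K : Type) [Field k] [CharP k p] [Field K] [Algebra k K]
        (O : ValuationSubring K) (A : Subalgebra k K), (∀ c : k, algebraMap k K c ∈ O) → A.FG →
        IsFractionRing ↥A K → A.toSubring ≤ O.toSubring → ¬ ringKrullDim ↥A ≤ 2 →
        (∀ n : ℕ, ringKrullDim ↥(tower O A n) = ringKrullDim ↥A) → ∃ m : ℕ, IsRegularLocalRing ↥(tower O A m)) :=
  FourFacts.cruxes_iff_primeDivisorCase_and_topDim'_of_facts4 (facts4_of_facts3 h3)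

end Summit.ResolutionOfSingularities.ResolutionOfSingularities.Theorems.SurfaceTermination.Reduction.ThreeFacts

end
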